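import Summits.AnomalousDissipation.AnomalousDissipation.Theorems.EnsembleRigidityGPStatisticalRigidityLinearTestLimit
import Summits.AnomalousDissipation.AnomalousDissipation.Theorems.EnsembleRigidityGPStatisticalRigidityGpSmallEnergy
import HarnessLib

/-!
# Stub `stub_gpLinearHorizon` of line `Sketch` (crux stmt-AnomalousDissipation-15508,
# `EnsembleRigidity.GPStatisticalRigidity`): the second-moment test with a general field `w`

THE LINEAR HORIZON. Let `f = f_GP` be the Galloway–Proctor force (`gpForce`) and `w ∈ 𝒱` a smooth
solenoidal mean-zero test field with the pointwise strain bound `⟪∇w(x) u, u⟫ ≥ −s |u|²` (`s ≥ 0`).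
For a probability measure `μ` on the energy space `H` with mean energy `∫ |v|² dμ ≤ E` the tested
generator of forced Euler against `w` obeys
`∫ ⟨f − B(v,v), w⟩ dμ = (f, w) + ∫∫ ⟪∇w v, v⟫ ≥ (f, w) − s ∫ |v|² dμ ≥ (f, w) − s E`,
while a cylindrical forced-Euler defect `≤ R` gives, after removing the cut-off
(`stub_linearTestLimit`), `|∫ ⟨f − B(v,v), w⟩ dμ| ≤ R ‖∇w‖₂`. Hence at every energy level
`E < (f, w)/s` no such measure has defect `R ≤ δ₀ := ((f,w) − sE)/(2(‖∇w‖₂ + 1))`, and the crux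
inequality `c ≤ R √G` holds vacuously there (`stub_gpLinearHorizon`, registered on the crux).
This generalises the landed small-energy test `stub_gpSmallEnergy` (`w = f_GP`, `s = 2π`).
-/

set_option linter.dupNamespace false

noncomputable section

namespace Summit.AnomalousDissipation.AnomalousDissipation.Theorems.EnsembleRigidity.GPStatisticalRigidity

open MeasureTheory Filter Topology UnitAddTorus
open scoped InnerProductSpace RealInnerProductSpace ENNReal NNReal
open Literature.Analysis.FunctionSpaces Literature.Analysis.FluidPDE
open Summit.AnomalousDissipation.AnomalousDissipation.Theorems.EnsembleRigidity

/-- Local notation: real vector fields on `T³`. -/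
local notation "Vec3" => (UnitAddTorus (Fin 3)) → (EuclideanSpace ℝ (Fin 3))
/-- Local notation: `L²(T³; ℝ³)`. -/
local notation "L2" => (Lp (EuclideanSpace ℝ (Fin 3)) 2 (volume : Measure (UnitAddTorus (Fin 3))))
/-- Local notation: the energy space `H`. -/
local notation "H3" => (Torus.energySpace (Fin 3))

/-! ## The inertial pairing against a field with bounded strain -/

-- adapted from `gpForce_inertialPairing_ge` (…GpSmallEnergy.lean): the pointwise bound is now the
-- hypothesis `hstrain` instead of the explicit computation for `f_GP`.
/-- **The inertial pairing against `w` is bounded below by the energy**: if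
`⟪∇w(x) u, u⟫ ≥ −s |u|²` pointwise, then `∫ ⟪∇w u, u⟫ ≥ −s ‖u‖²_{L²}` for every
`u ∈ L²(T³; ℝ³)`. [folklore] -/
theorem linearHorizon_inertialPairing_ge {w : Vec3} (hw : Torus.IsSmooth w) {s : ℝ}
    (hstrain : ∀ (x : UnitAddTorus (Fin 3)) (u : EuclideanSpace ℝ (Fin 3)),
      -(s * ‖u‖ ^ 2) ≤ ⟪Torus.fderiv w x u, u⟫_ℝ)
    (a : L2) : -(s * ‖a‖ ^ 2) ≤ Torus.inertialPairing a w := by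
  obtain ⟨C, _, hC⟩ := Torus.exists_sum_norm_partialDeriv_le hw
  have hI := (Torus.integrable_inner_fderiv_apply_coe hw hC a a).1
  have hn : Integrable (fun x => ‖(a : Vec3) x‖ ^ 2) volume :=
    (Lp.memLp a).integrable_norm_pow two_ne_zero
  rw [Torus.inertialPairing, ← Torus.integral_norm_sq_coe_eq, ← neg_mul, ← integral_const_mul]
  refine integral_mono (hn.const_mul _) hI fun x => ?_
  have h := hstrain x ((a : Vec3) x)
  rwa [← neg_mul] at h

/-- The inertial pairing against a smooth `w` is quadratically bounded: `|∫ ⟪∇w u, u⟫| ≤ C ‖u‖²`.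
[folklore] -/
theorem linearHorizon_abs_inertialPairing_le {w : Vec3} (hw : Torus.IsSmooth w) :
    ∃ C : ℝ, 0 ≤ C ∧ ∀ a : L2, |Torus.inertialPairing a w| ≤ C * ‖a‖ ^ 2 := by
  obtain ⟨C, hC0, hC⟩ := Torus.exists_sum_norm_partialDeriv_le hw
  refine ⟨C, hC0, fun a => ?_⟩
  have h := (Torus.integrable_inner_fderiv_apply_coe hw hC a a).2
  rw [Torus.inertialPairing, sq]
  exact h

/-- **The `μ`-averaged second-moment test.** For a smooth `w` with `⟪∇w(x) u, u⟫ ≥ −s |u|²`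
(`s ≥ 0`), any force `f` and a probability measure `μ` on `H` with `∫ |v|² dμ < ∞`:
`v ↦ ⟨f − B(v,v), w⟩` is `μ`-integrable and `∫ ⟨f − B(v,v), w⟩ dμ ≥ (f, w) − s ∫ |v|² dμ`. [folklore] -/
theorem linearHorizon_integral_nsGeneratorPairing_ge (f : Vec3) {w : Vec3} (hw : Torus.IsSmooth w)
    {s : ℝ} (hstrain : ∀ (x : UnitAddTorus (Fin 3)) (u : EuclideanSpace ℝ (Fin 3)),
      -(s * ‖u‖ ^ 2) ≤ ⟪Torus.fderiv w x u, u⟫_ℝ)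
    (μ : Measure H3) [IsProbabilityMeasure μ] (hint : Integrable (fun v : H3 => ‖v‖ ^ 2) μ) :
    (∫ x, ⟪f x, w x⟫_ℝ) - s * Torus.ensembleEnergy μ ≤
      ∫ v, Torus.nsGeneratorPairing 0 f v w ∂μ := by
  -- the tested generator, pointwise in `v`
  have hgen : ∀ v : H3, Torus.nsGeneratorPairing 0 f v w =
      (∫ x, ⟪f x, w x⟫_ℝ) + Torus.inertialPairing (v : L2) w := by
    intro v
    rw [Torus.nsGeneratorPairing, zero_mul, add_zero]
  -- integrability of `v ↦ ∫ (v ⊗ v) : ∇w` (continuous, quadratically bounded)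
  obtain ⟨C, _, hC⟩ := linearHorizon_abs_inertialPairing_le hw
  have hcont : Continuous fun v : H3 => Torus.inertialPairing (v : L2) w :=
    Torus.continuous_inertialPairing_coe hw
  have hInt : Integrable (fun v : H3 => Torus.inertialPairing (v : L2) w) μ := by
    refine Integrable.mono' (hint.const_mul C) hcont.aestronglyMeasurable (ae_of_all _ fun v => ?_)
    rw [Real.norm_eq_abs, Submodule.coe_norm]
    exact hC (v : L2)
  -- integrate
  have hI1 : ∫ v, Torus.nsGeneratorPairing 0 f v w ∂μ =
      (∫ x, ⟪f x, w x⟫_ℝ) + ∫ v, Torus.inertialPairing (v : L2) w ∂μ := by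
    simp_rw [hgen]
    rw [integral_add (integrable_const _) hInt, integral_const]
    simp
  have hI2 : -(s * Torus.ensembleEnergy μ) ≤ ∫ v, Torus.inertialPairing (v : L2) w ∂μ := by
    rw [Torus.ensembleEnergy, ← neg_mul, ← integral_const_mul]
    refine integral_mono (hint.const_mul _) hInt fun v => ?_
    have h := linearHorizon_inertialPairing_ge hw hstrain (v : L2)
    rw [Submodule.coe_norm, neg_mul]
    exact h
  linarith

/-! ## The stub -/

/-- **H `stub_gpLinearHorizon`** — THE LINEAR HORIZON OF THE SECOND-MOMENT TEST. For `f = f_GP`, a smooth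
solenoidal mean-zero `w` with `⟪∇w(x) u, u⟫ ≥ −s |u|²` (`s ≥ 0`) and an energy level `E` with
`s E < (f, w)`: there are `c, δ₀ > 0` such that every probability measure `μ` on `H` with mean energy
`≤ E`, finite mean enstrophy and cylindrical forced-Euler defect `≤ R ≤ δ₀` satisfies `c ≤ R √G` — in
fact no such `μ` exists: removing the cut-off (`stub_linearTestLimit`) gives
`|∫ ⟨f − B(v,v), w⟩ dμ| ≤ R ‖∇w‖₂`, while `∫ ⟨f − B(v,v), w⟩ dμ ≥ (f, w) − sE > 0`
(`linearHorizon_integral_nsGeneratorPairing_ge`), impossible for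
`R ≤ δ₀ = ((f,w) − sE)/(2(‖∇w‖₂ + 1))`. [folklore] -/
theorem stub_gpLinearHorizon (f w : Vec3) (hf : f = gpForce) (hw : Torus.IsSmooth w)
    (hdw : Torus.IsDivFree w) (hzw : Torus.HasZeroMean w) (s : ℝ) (hs : 0 ≤ s)
    (hstrain : ∀ (x : UnitAddTorus (Fin 3)) (u : EuclideanSpace ℝ (Fin 3)),
      -(s * ‖u‖ ^ 2) ≤ ⟪Torus.fderiv w x u, u⟫_ℝ)
    (E : ℝ) (hE : s * E < ∫ x, ⟪f x, w x⟫_ℝ) :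
    ∃ c δ₀ : ℝ, 0 < c ∧ 0 < δ₀ ∧ ∀ μ : Measure H3, IsProbabilityMeasure μ →
      Integrable (fun v : H3 => ‖v‖ ^ 2) μ → Torus.ensembleEnergy μ ≤ E →
      Torus.ensembleEnstrophy μ < ⊤ → ∀ R : ℝ, 0 ≤ R → R ≤ δ₀ →
      (∀ Φ : Torus.CylindricalTest (Fin 3),
        Integrable (fun v : H3 => Torus.nsGeneratorPairing 0 f v (Φ.grad v)) μ ∧
          |∫ v, Torus.nsGeneratorPairing 0 f v (Φ.grad v) ∂μ| ≤
            R * Real.sqrt (∫ v, Torus.gradNormSq (Φ.grad v) ∂μ)) →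
      c ≤ R * Real.sqrt (Torus.ensembleEnstrophy μ).toReal := by
  -- the data: `P = (f, w)`, `Q = ‖∇w‖₂`, `δ₀ = (P − sE)/(2(Q+1))`
  set P : ℝ := ∫ x, ⟪f x, w x⟫_ℝ with hP
  set Q : ℝ := Real.sqrt (Torus.gradNormSq w) with hQ
  have hQ0 : 0 ≤ Q := Real.sqrt_nonneg _
  have hgap : 0 < P - s * E := sub_pos.2 hE
  refine ⟨1, (P - s * E) / (2 * (Q + 1)), one_pos, by positivity, ?_⟩
  intro μ hμ hint hEn _ R _ hRδ hdef
  exfalso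
  have hf2 : MemLp f 2 volume := by
    rw [hf]
    exact gpForce_isSmooth.memLp 2
  -- (1) removing the cut-off: the balance against the fixed field `w`
  obtain ⟨-, hbal⟩ := stub_linearTestLimit f w hf2 hw hdw hzw μ hμ hint R hdef
  -- (2)–(3) the lower bound `∫ ⟨f − B(v,v), w⟩ dμ ≥ P − s e(μ) ≥ P − sE`
  have hlow := linearHorizon_integral_nsGeneratorPairing_ge f hw hstrain μ hint
  have hE' : s * Torus.ensembleEnergy μ ≤ s * E := mul_le_mul_of_nonneg_left hEn hs
  have habs := le_abs_self (∫ v, Torus.nsGeneratorPairing 0 f v w ∂μ)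
  -- (4) `P − sE ≤ R Q ≤ δ₀ Q < P − sE`
  have h1 : P - s * E ≤ R * Q := by linarith
  have h2 : R * Q ≤ (P - s * E) / (2 * (Q + 1)) * Q := mul_le_mul_of_nonneg_right hRδ hQ0
  have h3 : (P - s * E) / (2 * (Q + 1)) * Q < P - s * E := by
    rw [div_mul_eq_mul_div, div_lt_iff₀ (by positivity)]
    nlinarith
  linarith

end Summit.AnomalousDissipation.AnomalousDissipation.Theorems.EnsembleRigidity.GPStatisticalRigidity

end
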